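import Summits.BirchSwinnertonDyer.BirchSwinnertonDyer.Theorems.ByReductionTypeAtTwoAdditiveKatoTransportPrintExactAnyImageDefs
import Summits.BirchSwinnertonDyer.BirchSwinnertonDyer.Theorems.ByReductionTypeAtTwoAdditiveOddBranchFEDoorKeyGamma
import Summits.BirchSwinnertonDyer.BirchSwinnertonDyer.Theorems.ByReductionTypeAtTwoAdditiveOddBranchTwistFEDoor
import HarnessLib

/-!
# Route ByReductionTypeAtTwo, crux C4″ `AdditivePotMultOverKAtTwo` (stmt-BirchSwinnertonDyer-22618; parent
# `AdditiveRankZeroAtTwo` 19098) — R16, part 2: the object-level doors of T20 / R14 (c) for ALL FOUR split-twist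
# potentially-multiplicative sub-blocks, IMAGE-FREE and with the functional equation IN THE KERNEL: Kato's one-sided
# divisibility `ℓ_𝔮(X(W/ℚ_∞)) ≤ ℓ_𝔮(Λ/(L̃))` at EVERY height-one `𝔮 ∌ 2` (the exceptional prime of (12.5.1) included), keys
# `γ⁻¹` and `γ`, blocks `(−1)` and `(−2)`, from the ONE image-free print-exact package of
# `…AdditiveKatoTransportPrintExactAnyImageDefs.lean` (theorems only)

Cell `bsd-2adic`, seat `bsd-2adic-k4-w3` GEN 4 (explicit unit of director-bsd g16 (309)(7)). Each door below is the lane's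
door of the same name without `AnyImage` — addL2x GEN 16 `lengthAt_selmerDualContra_le_of_oddBranchInputsPrintExact{,_of_lengthAt_symm}`
(p683821), `lengthAt_selmerDual_le_of_oddBranchInputsPrintExact` (p685611), `…NegTwoPrintExact{,_of_lengthAt_symm}` (p684511),
in t42 GEN 21's `_fe` form (functional-equation binder `hLtι` discharged by
`MultOddBranchFE.map_invol_span_eq_of_eq_oddBranchMult{,Twist}_two_of_split`, Mazur–Tate–Teitelbaum §I.17 PROVED) — with the
typed input replaced by the IMAGE-FREE constant `KatoOddBranchInputsAtTwoNeg{One,Two}SplitTwistPrintExactAnyImage` and the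
binder `hirr : W.HasIrreducibleModPGaloisRep 2` GONE. The proofs are the lane's, verbatim: the kernel lemmas
`Kato2004.MultDivisibilityInputsContra.lengthAt_X_le_{off_factor, at_factor_of_transport, at_factor_of_lengthAt_symm}`
(`Kato2004/DivisibilityInputsContraExceptionalTransportProofs.lean`), the dichotomy «`π ∉ 𝔮 ∨ π ∉ ι𝔮`»
(`AddKatoTwo.not_mem_comap_invol_of_mem_five_X_add_{four,six}`), and for the key-`γ` doors the `ι`-twist of dual Selmer data
(`Kato2004.selmerDualData_exists_involTwist`, `…_lengthAt_eq_inv`, `…_finite_inv`, `…_map_invol_charIdeal_iff_inv`) never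
look at the image of `ρ̄_{W,2}`. NEW relative to the lane: the key-`γ` door of the `(−2)`-block
(`lengthAt_selmerDual_le_of_oddBranchInputsNegTwoPrintExactAnyImage_fe`; addL2x GEN 16 §6 (3) left it to a successor).

USE (R16). These six doors are the object-level content that T20 (irreducible blocks: `KatoSharpAtTwoAdditiveNeg{One,Two}SplitTwist`)
and R14 (c) (reducible blocks: `KatoMemberSharpAtTwoAdditiveNeg{One,Two}SplitTwistReducible`, where the member's Conj. 12.10 at
`𝔮₀` is LATTICE-FREE, R14 (b)) consume from the typed input; with them and the sequel file's image-free R15 all four block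
targets read through ONE constant, `KatoOddBranchInputsAtTwoNegOneSplitTwistPrintExactAnyImage`. The remaining displayed
hypothesis `hXι : ι(char X) = char X` (resp. its length form) is T20 (a) — Greenberg LNM 1716 Thm. 1.14 ×2 (PRINT, tree facts)
+ the twist-decomposition reading `hdec` (seat t42 GEN 23's lane, `lengthAt_selmerDual_symm_of_decomposition` p682778) —
untouched here.

HONEST FRAMING (D-0036 / D-0054): theorems only — no definition, no named fact, no instance, no `sorry`; route-independent
(no `Theses` import); CONDITIONAL on the named typed input (a `@[conjecture]` constant taken as hypothesis) and Kato's Thm.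
12.4 (2) (`Kato2004.thm12_4`, PRINT); types-the-object-of; closes none; nothing booked; BSD is not proved by any of this.
PARTITION: X5@2 additive potentially-multiplicative block, the four (−1)/(−2) × irreducible/reducible split-twist sub-blocks
× `p = 2`.

References: [Kato2004Asterisque] Thm. 12.4 (2) (p. 221), Thm. 12.5 (3)(4) with (12.5.1)/(12.5.2) (p. 222), Conj. 17.6
(p. 274), §17.3 (p. 273), §17.13 (pp. 279–280); [GreenbergLNM1716] Thm. 1.14 (p. 68), §1 (p. 60); [Greenberg1989] pp. 101–102
(`S^ι`); [MazurTateTeitelbaum1986Invent] §I.17; memo `run/shared/lean/pub/bsd-2adic/k4w3/gen4/VERDICT-22618-k4w3-GEN4.md`.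
-/

set_option autoImplicit false
-- the summit's namespace `Summit.BirchSwinnertonDyer.BirchSwinnertonDyer` (Sub = Summit) trips `dupNamespace`
set_option linter.dupNamespace false

noncomputable section

open scoped Classical MatrixGroups ModularForm

open Field CongruenceSubgroup WeierstrassCurve Literature.NumberTheory.EllipticCurves
  Literature.NumberTheory.EllipticCurves.ModularForms Literature.NumberTheory.EllipticCurves.IwasawaAlgebra
  Literature.NumberTheory.EllipticCurves.Module

namespace Summit.BirchSwinnertonDyer.BirchSwinnertonDyer.Theorems.AddKatoTwo

/-! ## §1 The (−1)-block, key `γ⁻¹` (print-exact datum) -/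

/-- **`ℓ_𝔮(X') ≤ ℓ_𝔮(Λ/(L̃))` at EVERY height-one `𝔮 ∌ 2` for the key-`γ⁻¹` dual Selmer datum `D'` of `W` (additive at `2`,
`W^{(−1)}` split multiplicative) — ANY image of `ρ̄_{W,2}`, functional equation in the kernel**, from: `Kato2004.thm12_4`
(PRINT), the image-free print-exact input `KatoOddBranchInputsAtTwoNegOneSplitTwistPrintExactAnyImage`, finite generation of
`D'.X`, the symmetry `ι(char D'.X) = char D'.X` (T20 (a); used only at `𝔮 ∋ 5T+4`) and an integral multiple `L̃ = 2^m L⁻ ≠ 0`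
of the odd branch (`(ι L̃) = (L̃)` by `MultOddBranchFE.map_invol_span_eq_of_eq_oddBranchMult_two_of_split`). Off `(5T+4)` the
package alone; at it, transport from `ι(5T+4) ≐ (T−4)`. Image-free twin of
`MultOddBranchFE.lengthAt_selmerDualContra_le_of_oddBranchInputsPrintExact_fe`.
[cite: Kato2004Asterisque, Thm. 12.4 (2) (p. 221), Thm. 12.5 (3) and (12.5.1) (p. 222), Conj. 17.6 (p. 274), §17.13 (pp. 279–280)]
[cite: GreenbergLNM1716, Thm. 1.14 (p. 68)] [cite: MazurTateTeitelbaum1986Invent, §I.17] -/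
theorem lengthAt_selmerDualContra_le_of_oddBranchInputsPrintExactAnyImage_fe (h12 : Kato2004.thm12_4)
    (hPE : KatoOddBranchInputsAtTwoNegOneSplitTwistPrintExactAnyImage)
    (W : WeierstrassCurve ℚ) [W.IsElliptic] [W.IsGloballyMinimal] [ContinuousSMul ℤ_[2] (W.tateModule 2)]
    {N : ℕ} [NeZero N] (f : CuspForm (Gamma0 N) 2) (κ : ZpExtension ℚ 2) (γ : absoluteGaloisGroup ℚ)
    (hsp : (W.quadraticTwist (-1)).HasSplitMultiplicativeReductionAtPrime 2)
    (hκ : κ.IsCyclotomic) (hγ : κ.IsTopGenerator γ)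
    (hγ' : IsCyclotomicVariable 2 γ) (hf : IsNewformOf (W.quadraticTwist (-1)) f)
    (I : Kato2004.IwasawaH1Data W 2 κ γ) (D' : W.SelmerDualData κ γ⁻¹) [Module.Finite (IwasawaAlgebra 2) D'.X]
    (hXι : (charIdeal (IwasawaAlgebra 2) D'.X).map (invol 2).toRingHom = charIdeal (IwasawaAlgebra 2) D'.X)
    (Lt : IwasawaAlgebra 2) (m : ℕ)
    (hLt : iwasawaToPowerSeries 2 Lt =
      PowerSeries.C ((2 : ℚ_[2]) ^ m) * padicLFunctionMinusBranchMult f (1 : ℚ_[2]) 1)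
    (hLt0 : Lt ≠ 0)
    (𝔮 : PrimeSpectrum (IwasawaAlgebra 2)) (h𝔮 : 𝔮.asIdeal.height = 1)
    (hp𝔮 : PowerSeries.C (2 : ℤ_[2]) ∉ 𝔮.asIdeal) :
    lengthAt (IwasawaAlgebra 2) D'.X 𝔮 ≤
      lengthAt (IwasawaAlgebra 2) (IwasawaAlgebra 2 ⧸ Ideal.span {Lt}) 𝔮 := by
  obtain ⟨K, -, -⟩ := hPE W f κ γ hsp hκ hγ hγ' hf I D'
  have hLtι : (Ideal.span {Lt}).map (invol 2).toRingHom = Ideal.span {Lt} :=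
    MultOddBranchFE.map_invol_span_eq_of_eq_oddBranchMult_two_of_split hsp hf hLt
  have hp2 : ((2 : ℕ) : ℚ_[2]) = (2 : ℚ_[2]) := by norm_num
  have hLt' : iwasawaToPowerSeries 2 Lt =
      PowerSeries.C (((2 : ℕ) : ℚ_[2]) ^ m) * padicLFunctionMinusBranchMult f (1 : ℚ_[2]) 1 := by
    rw [hp2]; exact hLt
  have hp𝔮' : PowerSeries.C ((2 : ℕ) : ℤ_[2]) ∉ 𝔮.asIdeal := by exact_mod_cast hp𝔮
  rcases not_mem_comap_invol_of_mem_five_X_add_four 𝔮 hp𝔮 with hoff | hat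
  · exact K.lengthAt_X_le_off_factor h12 hκ hγ hLt' hLt0 𝔮 h𝔮 hp𝔮' hoff
  · exact K.lengthAt_X_le_at_factor_of_transport h12 hκ hγ hLt' hLt0 𝔮 h𝔮 hp𝔮' hat hXι hLtι

/-- The LENGTH-form variant of `lengthAt_selmerDualContra_le_of_oddBranchInputsPrintExactAnyImage_fe` at one prime pair: with
`ℓ_{𝔮}(D'.X) = ℓ_{ι𝔮}(D'.X)` instead of the ideal form; finite generation of `D'.X` not needed. Image-free twin of
`MultOddBranchFE.lengthAt_selmerDualContra_le_of_oddBranchInputsPrintExact_of_lengthAt_symm_fe`.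
[cite: Kato2004Asterisque, Thm. 12.5 (3) and (12.5.1) (p. 222), §17.13 (pp. 279–280)] [cite: GreenbergLNM1716, Thm. 1.14 (p. 68)]
[cite: MazurTateTeitelbaum1986Invent, §I.17] -/
theorem lengthAt_selmerDualContra_le_of_oddBranchInputsPrintExactAnyImage_of_lengthAt_symm_fe (h12 : Kato2004.thm12_4)
    (hPE : KatoOddBranchInputsAtTwoNegOneSplitTwistPrintExactAnyImage)
    (W : WeierstrassCurve ℚ) [W.IsElliptic] [W.IsGloballyMinimal] [ContinuousSMul ℤ_[2] (W.tateModule 2)]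
    {N : ℕ} [NeZero N] (f : CuspForm (Gamma0 N) 2) (κ : ZpExtension ℚ 2) (γ : absoluteGaloisGroup ℚ)
    (hsp : (W.quadraticTwist (-1)).HasSplitMultiplicativeReductionAtPrime 2)
    (hκ : κ.IsCyclotomic) (hγ : κ.IsTopGenerator γ)
    (hγ' : IsCyclotomicVariable 2 γ) (hf : IsNewformOf (W.quadraticTwist (-1)) f)
    (I : Kato2004.IwasawaH1Data W 2 κ γ) (D' : W.SelmerDualData κ γ⁻¹)
    (Lt : IwasawaAlgebra 2) (m : ℕ)
    (hLt : iwasawaToPowerSeries 2 Lt =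
      PowerSeries.C ((2 : ℚ_[2]) ^ m) * padicLFunctionMinusBranchMult f (1 : ℚ_[2]) 1)
    (hLt0 : Lt ≠ 0)
    (𝔮 : PrimeSpectrum (IwasawaAlgebra 2)) (h𝔮 : 𝔮.asIdeal.height = 1)
    (hp𝔮 : PowerSeries.C (2 : ℤ_[2]) ∉ 𝔮.asIdeal)
    (hXsym : lengthAt (IwasawaAlgebra 2) D'.X 𝔮 =
      lengthAt (IwasawaAlgebra 2) D'.X (PrimeSpectrum.comap (invol 2).toRingHom 𝔮)) :
    lengthAt (IwasawaAlgebra 2) D'.X 𝔮 ≤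
      lengthAt (IwasawaAlgebra 2) (IwasawaAlgebra 2 ⧸ Ideal.span {Lt}) 𝔮 := by
  obtain ⟨K, -, -⟩ := hPE W f κ γ hsp hκ hγ hγ' hf I D'
  have hLtι : (Ideal.span {Lt}).map (invol 2).toRingHom = Ideal.span {Lt} :=
    MultOddBranchFE.map_invol_span_eq_of_eq_oddBranchMult_two_of_split hsp hf hLt
  have hp2 : ((2 : ℕ) : ℚ_[2]) = (2 : ℚ_[2]) := by norm_num
  have hLt' : iwasawaToPowerSeries 2 Lt =
      PowerSeries.C (((2 : ℕ) : ℚ_[2]) ^ m) * padicLFunctionMinusBranchMult f (1 : ℚ_[2]) 1 := by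
    rw [hp2]; exact hLt
  have hp𝔮' : PowerSeries.C ((2 : ℕ) : ℤ_[2]) ∉ 𝔮.asIdeal := by exact_mod_cast hp𝔮
  rcases not_mem_comap_invol_of_mem_five_X_add_four 𝔮 hp𝔮 with hoff | hat
  · exact K.lengthAt_X_le_off_factor h12 hκ hγ hLt' hLt0 𝔮 h𝔮 hp𝔮' hoff
  · exact K.lengthAt_X_le_at_factor_of_lengthAt_symm h12 hκ hγ hLt' hLt0 𝔮 h𝔮 hp𝔮' hat hXsym hLtι

/-! ## §2 The (−1)-block, key `γ` (the tree's dual Selmer datum) -/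

/-- **Kato's divisibility `ℓ_𝔮(X(W/ℚ_∞)) ≤ ℓ_𝔮(Λ/(L̃))` at EVERY height-one `𝔮 ∌ 2` for the KEY-`γ` dual Selmer datum of `W`
(additive at `2`, `W^{(−1)}` split multiplicative) — ANY image of `ρ̄_{W,2}`, functional equation in the kernel**, from the
image-free print-exact input (key `γ⁻¹`), `Kato2004.thm12_4`, `ι(char D.X) = char D.X` (T20 (a)) and `L̃ = 2^m L⁻ ≠ 0`. Proof
(addL2x GEN 16's, p685611): twist `D` to a key-`γ⁻¹` datum `D'` (`Kato2004.selmerDualData_exists_involTwist`), apply §1 at `ι𝔮`,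
transport back by `ℓ_𝔮(D.X) = ℓ_{ι𝔮}(D'.X)` and `(ι L̃) = (L̃)`. Image-free twin of
`MultOddBranchFE.lengthAt_selmerDual_le_of_oddBranchInputsPrintExact_fe`.
[cite: Kato2004Asterisque, Thm. 12.4 (2) (p. 221), Thm. 12.5 (3) and (12.5.1) (p. 222), §17.3 (p. 273), §17.13 (pp. 279–280)]
[cite: Greenberg1989, pp. 101–102 (S^ι)] [cite: GreenbergLNM1716, Thm. 1.14 (p. 68)] [cite: MazurTateTeitelbaum1986Invent, §I.17] -/
theorem lengthAt_selmerDual_le_of_oddBranchInputsPrintExactAnyImage_fe (h12 : Kato2004.thm12_4)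
    (hPE : KatoOddBranchInputsAtTwoNegOneSplitTwistPrintExactAnyImage)
    (W : WeierstrassCurve ℚ) [W.IsElliptic] [W.IsGloballyMinimal] [ContinuousSMul ℤ_[2] (W.tateModule 2)]
    {N : ℕ} [NeZero N] (f : CuspForm (Gamma0 N) 2) (κ : ZpExtension ℚ 2) (γ : absoluteGaloisGroup ℚ)
    (hsp : (W.quadraticTwist (-1)).HasSplitMultiplicativeReductionAtPrime 2)
    (hκ : κ.IsCyclotomic) (hγ : κ.IsTopGenerator γ)
    (hγ' : IsCyclotomicVariable 2 γ) (hf : IsNewformOf (W.quadraticTwist (-1)) f)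
    (I : Kato2004.IwasawaH1Data W 2 κ γ) (D : W.SelmerDualData κ γ) [Module.Finite (IwasawaAlgebra 2) D.X]
    (hXι : (charIdeal (IwasawaAlgebra 2) D.X).map (invol 2).toRingHom = charIdeal (IwasawaAlgebra 2) D.X)
    (Lt : IwasawaAlgebra 2) (m : ℕ)
    (hLt : iwasawaToPowerSeries 2 Lt =
      PowerSeries.C ((2 : ℚ_[2]) ^ m) * padicLFunctionMinusBranchMult f (1 : ℚ_[2]) 1)
    (hLt0 : Lt ≠ 0)
    (𝔮 : PrimeSpectrum (IwasawaAlgebra 2)) (h𝔮 : 𝔮.asIdeal.height = 1)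
    (hp𝔮 : PowerSeries.C (2 : ℤ_[2]) ∉ 𝔮.asIdeal) :
    lengthAt (IwasawaAlgebra 2) D.X 𝔮 ≤
      lengthAt (IwasawaAlgebra 2) (IwasawaAlgebra 2 ⧸ Ideal.span {Lt}) 𝔮 := by
  haveI : Fact (Nat.Prime 2) := ⟨Nat.prime_two⟩
  have hLtι : (Ideal.span {Lt}).map (invol 2).toRingHom = Ideal.span {Lt} :=
    MultOddBranchFE.map_invol_span_eq_of_eq_oddBranchMult_two_of_split hsp hf hLt
  -- the key-`γ⁻¹` twist of `D`
  obtain ⟨D', e, he, -⟩ := Kato2004.selmerDualData_exists_involTwist (mul_inv_cancel γ) D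
  haveI : Module.Finite (IwasawaAlgebra 2) D'.X := Kato2004.selmerDualData_finite_inv D D'
  have hX'ι : (charIdeal (IwasawaAlgebra 2) D'.X).map (invol 2).toRingHom = charIdeal (IwasawaAlgebra 2) D'.X :=
    (Kato2004.selmerDualData_map_invol_charIdeal_iff_inv D D').mp hXι
  -- the conjugate prime
  set 𝔮' := PrimeSpectrum.comap (invol 2).toRingHom 𝔮 with h𝔮'def
  have h𝔮' : 𝔮'.asIdeal.height = 1 := by rw [h𝔮'def, Kato2004.height_comap_invol]; exact h𝔮
  have hp𝔮' : PowerSeries.C (2 : ℤ_[2]) ∉ 𝔮'.asIdeal := by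
    intro h
    apply hp𝔮
    rw [h𝔮'def, PrimeSpectrum.comap_asIdeal, Ideal.mem_comap] at h
    change invol 2 (PowerSeries.C (2 : ℤ_[2])) ∈ 𝔮.asIdeal at h
    rwa [invol_C] at h
  -- the key-`γ⁻¹` door at `ι𝔮`
  have hA := lengthAt_selmerDualContra_le_of_oddBranchInputsPrintExactAnyImage_fe h12 hPE W f κ γ hsp hκ hγ hγ' hf I D'
    hX'ι Lt m hLt hLt0 𝔮' h𝔮' hp𝔮'
  -- transport back to key `γ` at `𝔮`
  rw [Kato2004.selmerDualData_lengthAt_eq_inv D D' 𝔮,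
    Kato2004.lengthAt_quotient_span_eq_comap_invol_of_map_invol_span_eq hLtι 𝔮]
  exact hA

/-! ## §3 The (−2)-block, key `γ⁻¹` -/

/-- **`ℓ_𝔮(X') ≤ ℓ_𝔮(Λ/(L̃))` at EVERY height-one `𝔮 ∌ 2` for the key-`γ⁻¹` dual Selmer datum `D'` of `W` (additive at `2`,
`W^{(−2)}` split multiplicative) — ANY image, functional equation in the kernel**, from: `Kato2004.thm12_4`, the image-free
input `KatoOddBranchInputsAtTwoNegTwoSplitTwistPrintExactAnyImage` (itself a THEOREM modulo the (−1) input by the sequel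
file's R15), finite generation of `D'.X`, `ι(char D'.X) = char D'.X` and an integral multiple `L̃ = 2^m L⁻₂ ≠ 0` of the
`ω·χ₂`-branch (`(ι L̃) = (L̃)` by `MultOddBranchFE.map_invol_span_eq_of_eq_oddBranchMultTwist_two_of_split`). Image-free twin of
`MultOddBranchFE.lengthAt_selmerDualContra_le_of_oddBranchInputsNegTwoPrintExact_fe`.
[cite: Kato2004Asterisque, Thm. 12.4 (2) (p. 221), Thm. 12.5 (3) and (12.5.1) (p. 222), Conj. 17.6 (p. 274), §17.13 (pp. 279–280)]
[cite: GreenbergLNM1716, Thm. 1.14 (p. 68)] [cite: MazurTateTeitelbaum1986Invent, §I.17] -/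
theorem lengthAt_selmerDualContra_le_of_oddBranchInputsNegTwoPrintExactAnyImage_fe (h12 : Kato2004.thm12_4)
    (hPE : KatoOddBranchInputsAtTwoNegTwoSplitTwistPrintExactAnyImage)
    (W : WeierstrassCurve ℚ) [W.IsElliptic] [W.IsGloballyMinimal] [ContinuousSMul ℤ_[2] (W.tateModule 2)]
    {N : ℕ} [NeZero N] (f : CuspForm (Gamma0 N) 2) (κ : ZpExtension ℚ 2) (γ : absoluteGaloisGroup ℚ)
    (hsp : (W.quadraticTwist (-2)).HasSplitMultiplicativeReductionAtPrime 2)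
    (hκ : κ.IsCyclotomic) (hγ : κ.IsTopGenerator γ)
    (hγ' : IsCyclotomicVariable 2 γ) (hf : IsNewformOf (W.quadraticTwist (-2)) f)
    (I : Kato2004.IwasawaH1Data W 2 κ γ) (D' : W.SelmerDualData κ γ⁻¹) [Module.Finite (IwasawaAlgebra 2) D'.X]
    (hXι : (charIdeal (IwasawaAlgebra 2) D'.X).map (invol 2).toRingHom = charIdeal (IwasawaAlgebra 2) D'.X)
    (Lt : IwasawaAlgebra 2) (m : ℕ)
    (hLt : iwasawaToPowerSeries 2 Lt =
      PowerSeries.C ((2 : ℚ_[2]) ^ m) * padicLFunctionMinusBranchMultTwist f (1 : ℚ_[2]) 1 (-1))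
    (hLt0 : Lt ≠ 0)
    (𝔮 : PrimeSpectrum (IwasawaAlgebra 2)) (h𝔮 : 𝔮.asIdeal.height = 1)
    (hp𝔮 : PowerSeries.C (2 : ℤ_[2]) ∉ 𝔮.asIdeal) :
    lengthAt (IwasawaAlgebra 2) D'.X 𝔮 ≤
      lengthAt (IwasawaAlgebra 2) (IwasawaAlgebra 2 ⧸ Ideal.span {Lt}) 𝔮 := by
  obtain ⟨K, -, -⟩ := hPE W f κ γ hsp hκ hγ hγ' hf I D'
  have hLtι : (Ideal.span {Lt}).map (invol 2).toRingHom = Ideal.span {Lt} :=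
    MultOddBranchFE.map_invol_span_eq_of_eq_oddBranchMultTwist_two_of_split hsp hf hLt
  have hp2 : ((2 : ℕ) : ℚ_[2]) = (2 : ℚ_[2]) := by norm_num
  have hLt' : iwasawaToPowerSeries 2 Lt =
      PowerSeries.C (((2 : ℕ) : ℚ_[2]) ^ m) * padicLFunctionMinusBranchMultTwist f (1 : ℚ_[2]) 1 (-1) := by
    rw [hp2]; exact hLt
  have hp𝔮' : PowerSeries.C ((2 : ℕ) : ℤ_[2]) ∉ 𝔮.asIdeal := by exact_mod_cast hp𝔮
  rcases not_mem_comap_invol_of_mem_five_X_add_six 𝔮 hp𝔮 with hoff | hat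
  · exact K.lengthAt_X_le_off_factor h12 hκ hγ hLt' hLt0 𝔮 h𝔮 hp𝔮' hoff
  · exact K.lengthAt_X_le_at_factor_of_transport h12 hκ hγ hLt' hLt0 𝔮 h𝔮 hp𝔮' hat hXι hLtι

/-- The LENGTH-form variant of `lengthAt_selmerDualContra_le_of_oddBranchInputsNegTwoPrintExactAnyImage_fe` at one prime pair
(`ℓ_{𝔮}(D'.X) = ℓ_{ι𝔮}(D'.X)` instead of the ideal form; finite generation not needed). Image-free twin of
`MultOddBranchFE.lengthAt_selmerDualContra_le_of_oddBranchInputsNegTwoPrintExact_of_lengthAt_symm_fe`.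
[cite: Kato2004Asterisque, Thm. 12.5 (3) and (12.5.1) (p. 222), §17.13 (pp. 279–280)] [cite: GreenbergLNM1716, Thm. 1.14 (p. 68)]
[cite: MazurTateTeitelbaum1986Invent, §I.17] -/
theorem lengthAt_selmerDualContra_le_of_oddBranchInputsNegTwoPrintExactAnyImage_of_lengthAt_symm_fe
    (h12 : Kato2004.thm12_4) (hPE : KatoOddBranchInputsAtTwoNegTwoSplitTwistPrintExactAnyImage)
    (W : WeierstrassCurve ℚ) [W.IsElliptic] [W.IsGloballyMinimal] [ContinuousSMul ℤ_[2] (W.tateModule 2)]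
    {N : ℕ} [NeZero N] (f : CuspForm (Gamma0 N) 2) (κ : ZpExtension ℚ 2) (γ : absoluteGaloisGroup ℚ)
    (hsp : (W.quadraticTwist (-2)).HasSplitMultiplicativeReductionAtPrime 2)
    (hκ : κ.IsCyclotomic) (hγ : κ.IsTopGenerator γ)
    (hγ' : IsCyclotomicVariable 2 γ) (hf : IsNewformOf (W.quadraticTwist (-2)) f)
    (I : Kato2004.IwasawaH1Data W 2 κ γ) (D' : W.SelmerDualData κ γ⁻¹)
    (Lt : IwasawaAlgebra 2) (m : ℕ)
    (hLt : iwasawaToPowerSeries 2 Lt =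
      PowerSeries.C ((2 : ℚ_[2]) ^ m) * padicLFunctionMinusBranchMultTwist f (1 : ℚ_[2]) 1 (-1))
    (hLt0 : Lt ≠ 0)
    (𝔮 : PrimeSpectrum (IwasawaAlgebra 2)) (h𝔮 : 𝔮.asIdeal.height = 1)
    (hp𝔮 : PowerSeries.C (2 : ℤ_[2]) ∉ 𝔮.asIdeal)
    (hXsym : lengthAt (IwasawaAlgebra 2) D'.X 𝔮 =
      lengthAt (IwasawaAlgebra 2) D'.X (PrimeSpectrum.comap (invol 2).toRingHom 𝔮)) :
    lengthAt (IwasawaAlgebra 2) D'.X 𝔮 ≤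
      lengthAt (IwasawaAlgebra 2) (IwasawaAlgebra 2 ⧸ Ideal.span {Lt}) 𝔮 := by
  obtain ⟨K, -, -⟩ := hPE W f κ γ hsp hκ hγ hγ' hf I D'
  have hLtι : (Ideal.span {Lt}).map (invol 2).toRingHom = Ideal.span {Lt} :=
    MultOddBranchFE.map_invol_span_eq_of_eq_oddBranchMultTwist_two_of_split hsp hf hLt
  have hp2 : ((2 : ℕ) : ℚ_[2]) = (2 : ℚ_[2]) := by norm_num
  have hLt' : iwasawaToPowerSeries 2 Lt =
      PowerSeries.C (((2 : ℕ) : ℚ_[2]) ^ m) * padicLFunctionMinusBranchMultTwist f (1 : ℚ_[2]) 1 (-1) := by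
    rw [hp2]; exact hLt
  have hp𝔮' : PowerSeries.C ((2 : ℕ) : ℤ_[2]) ∉ 𝔮.asIdeal := by exact_mod_cast hp𝔮
  rcases not_mem_comap_invol_of_mem_five_X_add_six 𝔮 hp𝔮 with hoff | hat
  · exact K.lengthAt_X_le_off_factor h12 hκ hγ hLt' hLt0 𝔮 h𝔮 hp𝔮' hoff
  · exact K.lengthAt_X_le_at_factor_of_lengthAt_symm h12 hκ hγ hLt' hLt0 𝔮 h𝔮 hp𝔮' hat hXsym hLtι

/-! ## §4 The (−2)-block, key `γ` (new door: addL2x GEN 16 §6 (3) left it to a successor) -/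

/-- **Kato's divisibility `ℓ_𝔮(X(W/ℚ_∞)) ≤ ℓ_𝔮(Λ/(L̃))` at EVERY height-one `𝔮 ∌ 2` for the KEY-`γ` dual Selmer datum of `W`
(additive at `2`, `W^{(−2)}` split multiplicative) — ANY image, functional equation in the kernel**, from the image-free
(−2) print-exact input (key `γ⁻¹`), `Kato2004.thm12_4`, `ι(char D.X) = char D.X` and an integral multiple `L̃ = 2^m L⁻₂ ≠ 0` of
the `ω·χ₂`-branch. Proof: the `ι`-twist argument of §2 with §3 at `ι𝔮`.
[cite: Kato2004Asterisque, Thm. 12.4 (2) (p. 221), Thm. 12.5 (3) and (12.5.1) (p. 222), §17.3 (p. 273), §17.13 (pp. 279–280)]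
[cite: Greenberg1989, pp. 101–102 (S^ι)] [cite: GreenbergLNM1716, Thm. 1.14 (p. 68)] [cite: MazurTateTeitelbaum1986Invent, §I.17] -/
theorem lengthAt_selmerDual_le_of_oddBranchInputsNegTwoPrintExactAnyImage_fe (h12 : Kato2004.thm12_4)
    (hPE : KatoOddBranchInputsAtTwoNegTwoSplitTwistPrintExactAnyImage)
    (W : WeierstrassCurve ℚ) [W.IsElliptic] [W.IsGloballyMinimal] [ContinuousSMul ℤ_[2] (W.tateModule 2)]
    {N : ℕ} [NeZero N] (f : CuspForm (Gamma0 N) 2) (κ : ZpExtension ℚ 2) (γ : absoluteGaloisGroup ℚ)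
    (hsp : (W.quadraticTwist (-2)).HasSplitMultiplicativeReductionAtPrime 2)
    (hκ : κ.IsCyclotomic) (hγ : κ.IsTopGenerator γ)
    (hγ' : IsCyclotomicVariable 2 γ) (hf : IsNewformOf (W.quadraticTwist (-2)) f)
    (I : Kato2004.IwasawaH1Data W 2 κ γ) (D : W.SelmerDualData κ γ) [Module.Finite (IwasawaAlgebra 2) D.X]
    (hXι : (charIdeal (IwasawaAlgebra 2) D.X).map (invol 2).toRingHom = charIdeal (IwasawaAlgebra 2) D.X)
    (Lt : IwasawaAlgebra 2) (m : ℕ)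
    (hLt : iwasawaToPowerSeries 2 Lt =
      PowerSeries.C ((2 : ℚ_[2]) ^ m) * padicLFunctionMinusBranchMultTwist f (1 : ℚ_[2]) 1 (-1))
    (hLt0 : Lt ≠ 0)
    (𝔮 : PrimeSpectrum (IwasawaAlgebra 2)) (h𝔮 : 𝔮.asIdeal.height = 1)
    (hp𝔮 : PowerSeries.C (2 : ℤ_[2]) ∉ 𝔮.asIdeal) :
    lengthAt (IwasawaAlgebra 2) D.X 𝔮 ≤
      lengthAt (IwasawaAlgebra 2) (IwasawaAlgebra 2 ⧸ Ideal.span {Lt}) 𝔮 := by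
  haveI : Fact (Nat.Prime 2) := ⟨Nat.prime_two⟩
  have hLtι : (Ideal.span {Lt}).map (invol 2).toRingHom = Ideal.span {Lt} :=
    MultOddBranchFE.map_invol_span_eq_of_eq_oddBranchMultTwist_two_of_split hsp hf hLt
  -- the key-`γ⁻¹` twist of `D`
  obtain ⟨D', e, he, -⟩ := Kato2004.selmerDualData_exists_involTwist (mul_inv_cancel γ) D
  haveI : Module.Finite (IwasawaAlgebra 2) D'.X := Kato2004.selmerDualData_finite_inv D D'
  have hX'ι : (charIdeal (IwasawaAlgebra 2) D'.X).map (invol 2).toRingHom = charIdeal (IwasawaAlgebra 2) D'.X :=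
    (Kato2004.selmerDualData_map_invol_charIdeal_iff_inv D D').mp hXι
  -- the conjugate prime
  set 𝔮' := PrimeSpectrum.comap (invol 2).toRingHom 𝔮 with h𝔮'def
  have h𝔮' : 𝔮'.asIdeal.height = 1 := by rw [h𝔮'def, Kato2004.height_comap_invol]; exact h𝔮
  have hp𝔮' : PowerSeries.C (2 : ℤ_[2]) ∉ 𝔮'.asIdeal := by
    intro h
    apply hp𝔮
    rw [h𝔮'def, PrimeSpectrum.comap_asIdeal, Ideal.mem_comap] at h
    change invol 2 (PowerSeries.C (2 : ℤ_[2])) ∈ 𝔮.asIdeal at h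
    rwa [invol_C] at h
  -- the key-`γ⁻¹` door at `ι𝔮`
  have hA := lengthAt_selmerDualContra_le_of_oddBranchInputsNegTwoPrintExactAnyImage_fe h12 hPE W f κ γ hsp hκ hγ hγ' hf
    I D' hX'ι Lt m hLt hLt0 𝔮' h𝔮' hp𝔮'
  -- transport back to key `γ` at `𝔮`
  rw [Kato2004.selmerDualData_lengthAt_eq_inv D D' 𝔮,
    Kato2004.lengthAt_quotient_span_eq_comap_invol_of_map_invol_span_eq hLtι 𝔮]
  exact hA

end Summit.BirchSwinnertonDyer.BirchSwinnertonDyer.Theorems.AddKatoTwo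

end
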